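import Mathlib
import Summits.ResolutionOfSingularities.ResolutionOfSingularities.Theorems.RadicialJungCleanModelsGenericSpreadTypeOne
import Summits.ResolutionOfSingularities.ResolutionOfSingularities.Theorems.RadicialJungCleanModelsContactChainOfCleanRegAt
import HarnessLib

/-!
# Route `RadicialJung`, crux `CleanModels` (stmt-ResolutionOfSingularities-15917), line `Sketch` rev 35, stub 6 `stub_cleanProp44` (X44c),
# work plan O8 / L7b-global, item (G1) for the clean type (2): clean-permissible UNLESS the unit representative is a `p`-th power modulo `𝔭 + 𝔮²`

Memo `Cruxes/CleanModels/Lines/Sketch-memo-hand2-g9-stubs-5-7.md` §3a (G1-type 2 = the deficiency set).  RING LEVEL: `A` a domain, `𝔭` a prime,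
`B = A_𝔭`, `K = Frac A`, `q₀, q₁` generating `𝔪_B`.  If the line of `G` has at `B` a UNIT representative `u` (the clean type (2) at the generic point
of the curve), then off ONE `g ∉ 𝔭`, at every prime `𝔮 ⊇ 𝔭` with `A_𝔮` regular and `(q₀,q₁)` a regular pair generating `𝔭A_𝔮`: EITHER the line is
clean-permissible for `𝔭A_𝔮` — the unit `v = s^{p−1} v₀` (cleared form of `u`) is residually not a `p`-th power (✓ `cleanPermissibleAt_of_unit`), or
`v − c^p` is a transversal regular parameter of contact one, i.e. `v − c^p ∈ 𝔪 ∖ (𝔭A_𝔮 + 𝔪²)` (✓ `cleanPermissibleAt_of_split` with one transversal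
factor) — OR `v ≡ c^p (mod 𝔭A_𝔮 + 𝔪²)` for some `c`: the DEFICIENCY condition `δ_𝔮(v̄) ≥ 2` of the memo (`exists_not_mem_forall_cleanPermissibleAt_or_deficient_of_generic_unit`).
Whether the deficient `𝔮` are finitely many is the one non-mechanical point of L7b-global (memo §3a; O7 flavour); at those points L7b's chain is needed.

Honest framing: OURS (bookkeeping); nothing here proves X44c or any case of `CleanModels`.
-/

noncomputable section

set_option linter.dupNamespace false -- mandated namespace of this single-conjunct summit

open IsLocalRing Literature.AlgebraicGeometry.Resolution

namespace Summit.ResolutionOfSingularities.ResolutionOfSingularities.Theorems.RadicialJung.CleanModels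

/-- **Generic behaviour of a unit representative along the curve (ring level).**  See the module docstring.
[cite: CossartPiltant2008, Prop. 4.4 (proof, p. 10)] [cite: Piltant2013, §2 Axiom 4] [cite: Matsumura1987, Thm. 14.2] -/
theorem exists_not_mem_forall_cleanPermissibleAt_or_deficient_of_generic_unit {A K : Type} [CommRing A] [IsDomain A] [Field K]
    [Algebra A K] [IsFractionRing A K] (p : ℕ) [hp : Fact p.Prime] [CharP K p] (𝔭 : Ideal A) [h𝔭 : 𝔭.IsPrime]
    (B : Type) [CommRing B] [IsLocalRing B] [Algebra A B] [IsLocalization.AtPrime B 𝔭] [Algebra B K] [IsScalarTower A B K]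
    (G : K) (cc : Fin p → K) (hcc : ∃ j : Fin p, (j : ℕ) ≠ 0 ∧ cc j ≠ 0) (u : B) (hu : IsUnit u)
    (hX : (∑ j : Fin p, cc j ^ p * G ^ (j : ℕ)) = algebraMap B K u) :
    ∃ (g v : A), g ∉ 𝔭 ∧ ∀ (𝔮 : Ideal A) [𝔮.IsPrime], g ∉ 𝔮 →
      ∀ (R : Type) [CommRing R] [IsRegularLocalRing R] [Algebra A R] [IsLocalization.AtPrime R 𝔮] [Algebra R K] [IsScalarTower A R K]
        (q : Fin 2 → A), IsRsopPart (fun j => algebraMap A R (q j)) →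
        Ideal.span (Set.range fun j => algebraMap A R (q j)) = Ideal.map (algebraMap A R) 𝔭 →
        IsUnit (algebraMap A R v) ∧
        ((∃ cc' : Fin p → K, (∃ j : Fin p, (j : ℕ) ≠ 0 ∧ cc' j ≠ 0) ∧
            (∑ j : Fin p, cc' j ^ p * G ^ (j : ℕ)) = algebraMap R K (algebraMap A R v) ∧
            CleanPermissibleAt p (algebraMap R K) G (Ideal.map (algebraMap A R) 𝔭)) ∨
          ∃ c : R, algebraMap A R v - c ^ p ∈ Ideal.map (algebraMap A R) 𝔭 ⊔ maximalIdeal R ^ 2) := by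
  classical
  have hmemP : ∀ x : A, algebraMap A B x ∈ maximalIdeal B ↔ x ∈ 𝔭 := fun x => IsLocalization.AtPrime.to_map_mem_maximal_iff B 𝔭 x
  have hunitP : ∀ x : A, IsUnit (algebraMap A B x) ↔ x ∉ 𝔭 := fun x => IsLocalization.AtPrime.isUnit_to_map_iff B 𝔭 x
  have hinjK : Function.Injective (algebraMap A K) := IsFractionRing.injective A K
  obtain ⟨⟨v₀, s⟩, hus⟩ := IsLocalization.surj 𝔭.primeCompl u
  have hs : (s : A) ∉ 𝔭 := s.2
  have hv₀ : v₀ ∉ 𝔭 := by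
    intro h
    have h1 : algebraMap A B v₀ ∈ maximalIdeal B := (hmemP v₀).mpr h
    rw [← hus] at h1
    exact (maximalIdeal.isMaximal B).ne_top (Ideal.eq_top_of_isUnit_mem _ h1 (hu.mul ((hunitP s).mpr hs)))
  set v : A := (s : A) ^ (p - 1) * v₀ with hvdef
  have hvφ : algebraMap A B v = algebraMap A B s ^ p * u := by
    have hp1 : p = (p - 1) + 1 := (Nat.sub_add_cancel hp.out.one_le).symm
    rw [hvdef, map_mul, map_pow, ← hus]
    conv_rhs => rw [hp1, pow_succ]
    ring
  have hsK : algebraMap A K s ≠ 0 := fun h0 => hs (by rw [(injective_iff_map_eq_zero _).mp hinjK _ h0]; exact 𝔭.zero_mem)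
  obtain ⟨hcc', hX'⟩ := rep_scale_mul_pow p G cc hcc (algebraMap A K s) _ hsK hX
  have hXv : (∑ j : Fin p, (fun j => cc j * algebraMap A K s) j ^ p * G ^ (j : ℕ)) = algebraMap A K v := by
    rw [hX', IsScalarTower.algebraMap_apply A B K (s : A), ← map_pow, ← map_mul, ← hvφ, ← IsScalarTower.algebraMap_apply]
  refine ⟨(s : A) * v₀, v, fun h => (h𝔭.mem_or_mem h).elim hs hv₀, ?_⟩
  intro 𝔮 _ hg R _ _ _ _ _ _ q hqrsop hqspan
  have hs𝔮 : (s : A) ∉ 𝔮 := fun h => hg (Ideal.mul_mem_right _ _ h)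
  have hv₀𝔮 : v₀ ∉ 𝔮 := fun h => hg (Ideal.mul_mem_left _ _ h)
  set ψ := algebraMap A R with hψ
  have hunitQ : ∀ y : A, y ∉ 𝔮 → IsUnit (ψ y) := fun y hy => (IsLocalization.AtPrime.isUnit_to_map_iff R 𝔮 y).mpr hy
  have hvunit : IsUnit (ψ v) := by rw [hvdef, map_mul, map_pow]; exact ((hunitQ _ hs𝔮).pow _).mul (hunitQ _ hv₀𝔮)
  refine ⟨hvunit, ?_⟩
  haveI hJreg : IsRegularLocalRing (R ⧸ (Ideal.map ψ 𝔭)) := by rw [← hqspan]; exact hqrsop.isRegularLocalRing_quotient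
  have hJm : (Ideal.map ψ 𝔭) ≤ maximalIdeal R := by rw [← hqspan]; exact hqrsop.span_range_le_maximalIdeal
  have hXR : (∑ j : Fin p, (fun j => cc j * algebraMap A K s) j ^ p * G ^ (j : ℕ)) = algebraMap R K (ψ v) := by
    rw [hXv, IsScalarTower.algebraMap_apply A R K]
  by_cases hdef : ∃ c : R, ψ v - c ^ p ∈ (Ideal.map ψ 𝔭) ⊔ maximalIdeal R ^ 2
  · exact Or.inr hdef
  left
  push Not at hdef
  by_cases hres : ∀ c : R, ψ v - c ^ p ∉ maximalIdeal R
  · exact ⟨_, hcc', hXR, cleanPermissibleAt_of_unit p (algebraMap R K) G (Ideal.map ψ 𝔭) _ hcc' (ψ v) hvunit hXR hres⟩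
  push Not at hres
  obtain ⟨c, hc⟩ := hres
  -- `w := ψ v − c^p` is a transversal parameter of contact one
  set w : R := ψ v - c ^ p with hwdef
  have hw2 : w ∉ (Ideal.map ψ 𝔭) ⊔ maximalIdeal R ^ 2 := hdef c
  obtain ⟨cc'', hcc'', hX''⟩ := rep_shift_sub_pow p (algebraMap R K) G _ hcc' (ψ v) c hXR
  -- in `R/(Ideal.map ψ 𝔭)`, the class of `w` is a regular parameter
  haveI : IsLocalHom (Ideal.Quotient.mk (Ideal.map ψ 𝔭)) :=
    isLocalHom_of_le_jacobson_bot (Ideal.map ψ 𝔭) (by rw [IsLocalRing.jacobson_eq_maximalIdeal ⊥ bot_ne_top]; exact hJm)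
  have hwbar : Ideal.Quotient.mk (Ideal.map ψ 𝔭) w ∈ maximalIdeal (R ⧸ (Ideal.map ψ 𝔭)) := by
    refine (mem_maximalIdeal _).mpr fun hunit => (mem_maximalIdeal _).mp hc ?_
    exact (isUnit_map_iff (Ideal.Quotient.mk (Ideal.map ψ 𝔭)) w).mp hunit
  have hmle : maximalIdeal (R ⧸ (Ideal.map ψ 𝔭)) ≤ (maximalIdeal R).map (Ideal.Quotient.mk (Ideal.map ψ 𝔭)) := by
    intro z hz
    obtain ⟨y, rfl⟩ := Ideal.Quotient.mk_surjective z
    have hy : y ∈ maximalIdeal R := (mem_maximalIdeal _).mpr fun hyu => (mem_maximalIdeal _).mp hz (hyu.map _)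
    exact Ideal.mem_map_of_mem _ hy
  have hwbar2 : Ideal.Quotient.mk (Ideal.map ψ 𝔭) w ∉ maximalIdeal (R ⧸ (Ideal.map ψ 𝔭)) ^ 2 := by
    intro h
    have h1 : Ideal.Quotient.mk (Ideal.map ψ 𝔭) w ∈ ((maximalIdeal R) ^ 2).map (Ideal.Quotient.mk (Ideal.map ψ 𝔭)) := by
      rw [Ideal.map_pow]; exact Ideal.pow_right_mono hmle 2 h
    rw [Ideal.mem_map_iff_of_surjective _ Ideal.Quotient.mk_surjective] at h1
    obtain ⟨y, hy, hyw⟩ := h1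
    apply hw2
    have : w = y + (w - y) := by ring
    rw [this]
    refine Ideal.add_mem _ (Ideal.mem_sup_right hy) (Ideal.mem_sup_left ?_)
    rw [← Ideal.Quotient.eq, hyw]
  have hbrsop : IsRsopPart (Ideal.Quotient.mk (Ideal.map ψ 𝔭) ∘ ![w]) := by
    have : (Ideal.Quotient.mk (Ideal.map ψ 𝔭) ∘ ![w]) = ![Ideal.Quotient.mk (Ideal.map ψ 𝔭) w] := by ext i; fin_cases i; rfl
    rw [this]
    exact isRsopPart_singleton_of_not_mem_sq hwbar hwbar2
  have harsop : IsRsopPart (Fin.elim0 : Fin 0 → R) := by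
    refine ⟨inferInstance, (maximalIdeal R).spanFinrank, Classical.choose (exists_regularSystemOfParameters (R := R)), ?_, ?_⟩
    · rw [zero_add]; exact (IsRegularLocalRing.spanFinrank_maximalIdeal (R := R)).symm
    · rw [Set.range_eq_empty, Set.empty_union]
      exact Classical.choose_spec (exists_regularSystemOfParameters (R := R))
  have hX3 : (∑ j : Fin p, cc'' j ^ p * G ^ (j : ℕ)) =
      algebraMap R K (1 * (∏ k : Fin 0, (Fin.elim0 k : R) ^ (Fin.elim0 k : ℕ)) * ∏ k : Fin 1, (![w] : Fin 1 → R) k ^ (![1] : Fin 1 → ℕ) k) := by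
    rw [hX'']; simp [hwdef]
  refine ⟨_, hcc', hXR, ?_⟩
  exact cleanPermissibleAt_of_split p (algebraMap R K) G (Ideal.map ψ 𝔭) cc'' hcc'' Fin.elim0 ![w] harsop (fun k => Fin.elim0 k)
    (fun k => by fin_cases k; exact hc) hbrsop Fin.elim0 ![1] (Or.inr ⟨0, by simpa using hp.out.one_lt.ne'⟩) 1 isUnit_one hX3


/-- The same, EXPORTING the cleared unit representative: `Σ cc'_j^p G^j = v` in `K` with `v ∈ A`, a unit at every good `𝔮` — the form consumed
by the assembly over a clean form of type (2) at the generic point (the deficiency disjunct then refers to THIS representative).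
[cite: CossartPiltant2008, Prop. 4.4 (proof, p. 10)] [cite: Piltant2013, §2 Axiom 4] -/
theorem exists_rep_not_mem_forall_cleanPermissibleAt_or_deficient_of_generic_unit {A K : Type} [CommRing A] [IsDomain A] [Field K]
    [Algebra A K] [IsFractionRing A K] (p : ℕ) [hp : Fact p.Prime] [CharP K p] (𝔭 : Ideal A) [h𝔭 : 𝔭.IsPrime]
    (B : Type) [CommRing B] [IsLocalRing B] [Algebra A B] [IsLocalization.AtPrime B 𝔭] [Algebra B K] [IsScalarTower A B K]
    (G : K) (cc : Fin p → K) (hcc : ∃ j : Fin p, (j : ℕ) ≠ 0 ∧ cc j ≠ 0) (u : B) (hu : IsUnit u)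
    (hX : (∑ j : Fin p, cc j ^ p * G ^ (j : ℕ)) = algebraMap B K u) :
    ∃ (g v : A) (cc' : Fin p → K), g ∉ 𝔭 ∧ (∃ j : Fin p, (j : ℕ) ≠ 0 ∧ cc' j ≠ 0) ∧
      (∑ j : Fin p, cc' j ^ p * G ^ (j : ℕ)) = algebraMap A K v ∧ ∀ (𝔮 : Ideal A) [𝔮.IsPrime], g ∉ 𝔮 →
      ∀ (R : Type) [CommRing R] [IsRegularLocalRing R] [Algebra A R] [IsLocalization.AtPrime R 𝔮] [Algebra R K] [IsScalarTower A R K]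
        (q : Fin 2 → A), IsRsopPart (fun j => algebraMap A R (q j)) →
        Ideal.span (Set.range fun j => algebraMap A R (q j)) = Ideal.map (algebraMap A R) 𝔭 →
        IsUnit (algebraMap A R v) ∧
        (CleanPermissibleAt p (algebraMap R K) G (Ideal.map (algebraMap A R) 𝔭) ∨
          ∃ c : R, algebraMap A R v - c ^ p ∈ Ideal.map (algebraMap A R) 𝔭 ⊔ maximalIdeal R ^ 2) := by
  classical
  have hmemP : ∀ x : A, algebraMap A B x ∈ maximalIdeal B ↔ x ∈ 𝔭 := fun x => IsLocalization.AtPrime.to_map_mem_maximal_iff B 𝔭 x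
  have hunitP : ∀ x : A, IsUnit (algebraMap A B x) ↔ x ∉ 𝔭 := fun x => IsLocalization.AtPrime.isUnit_to_map_iff B 𝔭 x
  have hinjK : Function.Injective (algebraMap A K) := IsFractionRing.injective A K
  obtain ⟨⟨v₀, s⟩, hus⟩ := IsLocalization.surj 𝔭.primeCompl u
  have hs : (s : A) ∉ 𝔭 := s.2
  have hv₀ : v₀ ∉ 𝔭 := by
    intro h
    have h1 : algebraMap A B v₀ ∈ maximalIdeal B := (hmemP v₀).mpr h
    rw [← hus] at h1
    exact (maximalIdeal.isMaximal B).ne_top (Ideal.eq_top_of_isUnit_mem _ h1 (hu.mul ((hunitP s).mpr hs)))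
  set v : A := (s : A) ^ (p - 1) * v₀ with hvdef
  have hvφ : algebraMap A B v = algebraMap A B s ^ p * u := by
    have hp1 : p = (p - 1) + 1 := (Nat.sub_add_cancel hp.out.one_le).symm
    rw [hvdef, map_mul, map_pow, ← hus]
    conv_rhs => rw [hp1, pow_succ]
    ring
  have hsK : algebraMap A K s ≠ 0 := fun h0 => hs (by rw [(injective_iff_map_eq_zero _).mp hinjK _ h0]; exact 𝔭.zero_mem)
  obtain ⟨hcc', hX'⟩ := rep_scale_mul_pow p G cc hcc (algebraMap A K s) _ hsK hX
  have hXv : (∑ j : Fin p, (fun j => cc j * algebraMap A K s) j ^ p * G ^ (j : ℕ)) = algebraMap A K v := by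
    rw [hX', IsScalarTower.algebraMap_apply A B K (s : A), ← map_pow, ← map_mul, ← hvφ, ← IsScalarTower.algebraMap_apply]
  refine ⟨(s : A) * v₀, v, _, fun h => (h𝔭.mem_or_mem h).elim hs hv₀, hcc', hXv, ?_⟩
  intro 𝔮 _ hg R _ _ _ _ _ _ q hqrsop hqspan
  have hs𝔮 : (s : A) ∉ 𝔮 := fun h => hg (Ideal.mul_mem_right _ _ h)
  have hv₀𝔮 : v₀ ∉ 𝔮 := fun h => hg (Ideal.mul_mem_left _ _ h)
  set ψ := algebraMap A R with hψ
  have hunitQ : ∀ y : A, y ∉ 𝔮 → IsUnit (ψ y) := fun y hy => (IsLocalization.AtPrime.isUnit_to_map_iff R 𝔮 y).mpr hy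
  have hvunit : IsUnit (ψ v) := by rw [hvdef, map_mul, map_pow]; exact ((hunitQ _ hs𝔮).pow _).mul (hunitQ _ hv₀𝔮)
  refine ⟨hvunit, ?_⟩
  haveI hJreg : IsRegularLocalRing (R ⧸ (Ideal.map ψ 𝔭)) := by rw [← hqspan]; exact hqrsop.isRegularLocalRing_quotient
  have hJm : (Ideal.map ψ 𝔭) ≤ maximalIdeal R := by rw [← hqspan]; exact hqrsop.span_range_le_maximalIdeal
  have hXR : (∑ j : Fin p, (fun j => cc j * algebraMap A K s) j ^ p * G ^ (j : ℕ)) = algebraMap R K (ψ v) := by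
    rw [hXv, IsScalarTower.algebraMap_apply A R K]
  by_cases hdef : ∃ c : R, ψ v - c ^ p ∈ (Ideal.map ψ 𝔭) ⊔ maximalIdeal R ^ 2
  · exact Or.inr hdef
  left
  push Not at hdef
  by_cases hres : ∀ c : R, ψ v - c ^ p ∉ maximalIdeal R
  · exact cleanPermissibleAt_of_unit p (algebraMap R K) G (Ideal.map ψ 𝔭) _ hcc' (ψ v) hvunit hXR hres
  push Not at hres
  obtain ⟨c, hc⟩ := hres
  -- `w := ψ v − c^p` is a transversal parameter of contact one
  set w : R := ψ v - c ^ p with hwdef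
  have hw2 : w ∉ (Ideal.map ψ 𝔭) ⊔ maximalIdeal R ^ 2 := hdef c
  obtain ⟨cc'', hcc'', hX''⟩ := rep_shift_sub_pow p (algebraMap R K) G _ hcc' (ψ v) c hXR
  -- in `R/(Ideal.map ψ 𝔭)`, the class of `w` is a regular parameter
  haveI : IsLocalHom (Ideal.Quotient.mk (Ideal.map ψ 𝔭)) :=
    isLocalHom_of_le_jacobson_bot (Ideal.map ψ 𝔭) (by rw [IsLocalRing.jacobson_eq_maximalIdeal ⊥ bot_ne_top]; exact hJm)
  have hwbar : Ideal.Quotient.mk (Ideal.map ψ 𝔭) w ∈ maximalIdeal (R ⧸ (Ideal.map ψ 𝔭)) := by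
    refine (mem_maximalIdeal _).mpr fun hunit => (mem_maximalIdeal _).mp hc ?_
    exact (isUnit_map_iff (Ideal.Quotient.mk (Ideal.map ψ 𝔭)) w).mp hunit
  have hmle : maximalIdeal (R ⧸ (Ideal.map ψ 𝔭)) ≤ (maximalIdeal R).map (Ideal.Quotient.mk (Ideal.map ψ 𝔭)) := by
    intro z hz
    obtain ⟨y, rfl⟩ := Ideal.Quotient.mk_surjective z
    have hy : y ∈ maximalIdeal R := (mem_maximalIdeal _).mpr fun hyu => (mem_maximalIdeal _).mp hz (hyu.map _)
    exact Ideal.mem_map_of_mem _ hy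
  have hwbar2 : Ideal.Quotient.mk (Ideal.map ψ 𝔭) w ∉ maximalIdeal (R ⧸ (Ideal.map ψ 𝔭)) ^ 2 := by
    intro h
    have h1 : Ideal.Quotient.mk (Ideal.map ψ 𝔭) w ∈ ((maximalIdeal R) ^ 2).map (Ideal.Quotient.mk (Ideal.map ψ 𝔭)) := by
      rw [Ideal.map_pow]; exact Ideal.pow_right_mono hmle 2 h
    rw [Ideal.mem_map_iff_of_surjective _ Ideal.Quotient.mk_surjective] at h1
    obtain ⟨y, hy, hyw⟩ := h1
    apply hw2
    have : w = y + (w - y) := by ring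
    rw [this]
    refine Ideal.add_mem _ (Ideal.mem_sup_right hy) (Ideal.mem_sup_left ?_)
    rw [← Ideal.Quotient.eq, hyw]
  have hbrsop : IsRsopPart (Ideal.Quotient.mk (Ideal.map ψ 𝔭) ∘ ![w]) := by
    have : (Ideal.Quotient.mk (Ideal.map ψ 𝔭) ∘ ![w]) = ![Ideal.Quotient.mk (Ideal.map ψ 𝔭) w] := by ext i; fin_cases i; rfl
    rw [this]
    exact isRsopPart_singleton_of_not_mem_sq hwbar hwbar2
  have harsop : IsRsopPart (Fin.elim0 : Fin 0 → R) := by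
    refine ⟨inferInstance, (maximalIdeal R).spanFinrank, Classical.choose (exists_regularSystemOfParameters (R := R)), ?_, ?_⟩
    · rw [zero_add]; exact (IsRegularLocalRing.spanFinrank_maximalIdeal (R := R)).symm
    · rw [Set.range_eq_empty, Set.empty_union]
      exact Classical.choose_spec (exists_regularSystemOfParameters (R := R))
  have hX3 : (∑ j : Fin p, cc'' j ^ p * G ^ (j : ℕ)) =
      algebraMap R K (1 * (∏ k : Fin 0, (Fin.elim0 k : R) ^ (Fin.elim0 k : ℕ)) * ∏ k : Fin 1, (![w] : Fin 1 → R) k ^ (![1] : Fin 1 → ℕ) k) := by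
    rw [hX'']; simp [hwdef]
  exact cleanPermissibleAt_of_split p (algebraMap R K) G (Ideal.map ψ 𝔭) cc'' hcc'' Fin.elim0 ![w] harsop (fun k => Fin.elim0 k)
    (fun k => by fin_cases k; exact hc) hbrsop Fin.elim0 ![1] (Or.inr ⟨0, by simpa using hp.out.one_lt.ne'⟩) 1 isUnit_one hX3

end Summit.ResolutionOfSingularities.ResolutionOfSingularities.Theorems.RadicialJung.CleanModels

end
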